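import Summits.ResolutionOfSingularities.ResolutionOfSingularities.Theorems.FrobeniusLadderFInjectiveMacaulayficationFDStorey1FanTables
import Summits.ResolutionOfSingularities.ResolutionOfSingularities.Theorems.FrobeniusLadderFInjectiveMacaulayficationFanCheckChunks
import HarnessLib

/-!
# HEAVY KERNEL CHECKS (fan side) of the BED D storey-1 certificate: shapes, (hgen), unimodularity, vertex bridge, pure powers, (hAJ), and the vertex property
# (hge) RAY-CHUNK BY RAY-CHUNK — each ONE `decide +kernel` on the tables of `FDStorey1FanTables`
# (crux `FInjectiveMacaulayfication` stmt-ResolutionOfSingularities-15315, chain w45a; (W-TD) BED D storey 1 (D-1), res-L1-w45a-plan-1 R21.18 (4); seat res-L1-w45a-stub-2 g10)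

Support file for crux stmt-ResolutionOfSingularities-15315 (`FrobeniusLadder.FInjectiveMacaulayfication`), chain w45a.
[OURS · L1 W4.5a] — NOT a statement of any manuscript; AI-written, weaker than expert review.

The Boolean checks of res-L1-w45a-stub-4's `FanCheckKit` (+ this seat's `FanCheckMulti` / `FanCheckChunks`) on the BED D storey-1 data (`f_D = z⁴+x⁵z+x⁶+y³+u³+t⁷`, char 2,
res-L1-w45a-tri-2's fan `Σ_D^{𝔪K}`, 327 charts, centre `𝔪·K` with `|K| = 1967`, 9835 generators): `checkShapes`, `CL.length = 327`, `checkHgen`, `checkDetUnit`,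
`FanCheckMulti.checkMVBridge`, `checkHprim`, `checkHAJ`, the length check of `KL2`, and the vertex property `checkHge` as FIVE ray-chunk checks `checkHgeFrom AL2 CL (11k) RAYS_k`
(≈ 35 s each; the one-pass check exceeds the kernel budget) glued by `FanCheckChunks.checkHgeFrom_append_true`. The cover records are checked in `FDStorey1CoverChecks`, the
polynomial side in `FDStorey1PolyChecks`; the binders are `FDStorey1Fan`. No definitions, no named facts. [folklore; cite: CoxLittleSchenck2011, §2.3]
-/

-- single-problem summit: the doubled namespace component is forced
set_option linter.dupNamespace false

namespace Summit.ResolutionOfSingularities.ResolutionOfSingularities.Theorems.FInjectiveMacaulayfication.FDStorey1Fan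

open Summit.ResolutionOfSingularities.ResolutionOfSingularities.Theorems.FInjectiveMacaulayfication
open FanCheckKit FanCheckSound

/-! ## Light checks (ONE `decide`; bundled with `CL.length = 327`, which keeps every statement distinct from the sibling fan modules) -/

/-- (shapes, tlen, hgen, hV, vertex bridge, hprim, hAJ, lengths of `K`'s table): the light fan-side checks, as one conjunction. -/
theorem fan_checks : CL.length = 327 ∧ checkShapes 5 1 AL2 RAYS CL = true ∧ checkHgen 5 AL2 RAYS CL = true ∧ checkDetUnit 5 RAYS CL VinvTL = true ∧
    FanCheckMulti.checkMVBridge 5 AL2 MV2 50 327 CL = true ∧ checkHprim 5 AL2 PJ = true ∧ checkHAJ AL2 = true ∧ (KL2.all fun ch => allLen 5 ch) = true := by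
  decide +kernel

/-- 327 charts. -/
theorem tlen : CL.length = 327 := fan_checks.1

/-- (shapes) lengths and index bounds of all tables. -/
theorem shapes : checkShapes 5 1 AL2 RAYS CL = true ∧ CL.length = 327 := ⟨fan_checks.2.1, tlen⟩

/-- (hgen) `V c · a c i = V c · m c + e_i`. -/
theorem check_hgen : checkHgen 5 AL2 RAYS CL = true ∧ CL.length = 327 := ⟨fan_checks.2.2.1, tlen⟩

/-- (hV) `V c · W c = 1` over `ℤ`. -/
theorem check_det : checkDetUnit 5 RAYS CL VinvTL = true ∧ CL.length = 327 := ⟨fan_checks.2.2.2.1, tlen⟩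

/-- The vertex table `MV2` agrees with the chart records. -/
theorem check_mvbridge : FanCheckMulti.checkMVBridge 5 AL2 MV2 50 327 CL = true := fan_checks.2.2.2.2.1

/-- (hprim) pure powers of all five variables among the generators. -/
theorem check_hprim : checkHprim 5 AL2 PJ = true ∧ CL.length = 327 := ⟨fan_checks.2.2.2.2.2.1, tlen⟩

/-- (hAJ) no generator is `0`. -/
theorem check_hAJ : checkHAJ AL2 = true ∧ CL.length = 327 := ⟨fan_checks.2.2.2.2.2.2.1, tlen⟩

/-- Every chunk of `K`'s table consists of vectors of length 5. -/
theorem check_klen : (KL2.all fun ch => allLen 5 ch) = true ∧ CL.length = 327 := ⟨fan_checks.2.2.2.2.2.2.2, tlen⟩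

/-- 55 rays in five chunks of 11. -/
theorem rlens : RAYS_0.length = 11 ∧ RAYS_1.length = 11 ∧ RAYS_2.length = 11 ∧ RAYS_3.length = 11 ∧ RAYS_4.length = 11 := by decide +kernel

/-! ## (hge) ray-chunk by ray-chunk -/

/-- (hge), rays 0–10. -/
theorem check_hge_0 : checkHgeFrom AL2 CL 0 RAYS_0 = true := by decide +kernel

/-- (hge), rays 11–21. -/
theorem check_hge_1 : checkHgeFrom AL2 CL 11 RAYS_1 = true := by decide +kernel

/-- (hge), rays 22–32. -/
theorem check_hge_2 : checkHgeFrom AL2 CL 22 RAYS_2 = true := by decide +kernel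

/-- (hge), rays 33–43. -/
theorem check_hge_3 : checkHgeFrom AL2 CL 33 RAYS_3 = true := by decide +kernel

/-- (hge), rays 44–54. -/
theorem check_hge_4 : checkHgeFrom AL2 CL 44 RAYS_4 = true := by decide +kernel

/-- ★ (hge) the vertex property on all 55 rays, glued from the five chunks (with the specimen-distinct conjunct `CL.length = 327`). -/
theorem check_hge : checkHge AL2 RAYS CL = true ∧ CL.length = 327 := by
  refine ⟨?_, tlen⟩
  obtain ⟨h0, h1, h2, h3, h4⟩ := rlens
  rw [checkHge, RAYS]
  refine FanCheckChunks.checkHgeFrom_append_true (FanCheckChunks.checkHgeFrom_append_true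
    (FanCheckChunks.checkHgeFrom_append_true (FanCheckChunks.checkHgeFrom_append_true check_hge_0 ?_) ?_) ?_) ?_
  · rw [h0]; exact check_hge_1
  · rw [List.length_append, h0, h1]; exact check_hge_2
  · rw [List.length_append, List.length_append, h0, h1, h2]; exact check_hge_3
  · rw [List.length_append, List.length_append, List.length_append, h0, h1, h2, h3]; exact check_hge_4

end Summit.ResolutionOfSingularities.ResolutionOfSingularities.Theorems.FInjectiveMacaulayfication.FDStorey1Fan
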